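import Mathlib.NumberTheory.ArithmeticFunction.VonMangoldt
import Mathlib.Analysis.Complex.Basic
import Mathlib.Analysis.Complex.ExponentialBounds
import Mathlib.Data.Nat.Factorization.Basic
import Mathlib.Algebra.Order.BigOperators.Ring.Finset

/-!
# Two-block (Schur complement) inequality and parity reindexing for the divisor-graph Dirichlet gap
(tools for stub `stub_divisorGapPerp`, line `Sketch` of crux `WeilComb.CombShapePositivity`,
item stmt-RiemannHypothesis-11229, plan id B6; used by `…DivisorGapParityStep`)

The divisor graph on `[1, M]` (vertices `k ≤ M`, an edge `m — nm` of weight `Λ(n)` for every prime power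
`n`) splits into the odd numbers, the even numbers `2·[1, ⌊M/2⌋]` (an exact copy of the whole graph at
`⌊M/2⌋`) and the cross edges `r — 2^a r` (`r` odd, weight `log 2`).  This file provides the two
ingredients of the corresponding two-block reduction of the spectral gap:

* `twoBlock_real`, `twoBlock_complex` : the scalar Schur-complement inequality
  `|aO|²/UO + |aE|²/UE − |aO+aE|²/(UO+UE) ≤ K |t/UE − aO/UO|² + (L/UE)|aE − t|²`,
  `K = L·UO·UE/(L(UO+UE) − UO)`, valid when `UO < L(UO+UE)` (total-variance decomposition over two
  blocks + exact minimisation over the mean of the second block);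
* `sum_filter_even_eq_sum_half`, `sum_filter_odd_eq_add_sum`, `sum_odd_sum_twoPow_eq_sum_even`
  (the dyadic parametrisation `k = 2^a m`, `m` odd, `1 ≤ a ≤ ⌊log₂(M/m)⌋`, of the even numbers `≤ M`),
  `sum_Icc_inv_two_pow`, and the only arithmetic input of the parity step,
  `sum_odd_inv_lt_log_two_mul : Σ_{r ≤ M odd} 1/r < log 2 · H_M` (`M ≥ 6`).
-/
noncomputable section

-- the sub-problem path RiemannHypothesis/RiemannHypothesis duplicates a namespace (D-0017)
set_option linter.dupNamespace false

open scoped BigOperators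
open Finset

namespace Summit.RiemannHypothesis.RiemannHypothesis.Theorems.WeilCombBohrFejer

/-! ## The scalar two-block inequality -/

/-- Real core of the two-block (Schur complement) inequality: for `0 < UO`, `0 < UE`,
`UO < L (UO + UE)` and every real `α, β, τ`,
`α²/UO + β²/UE − (α+β)²/(UO+UE) ≤ K (τ/UE − α/UO)² + (L/UE)(β − τ)²` with
`K = L·UO·UE / (L(UO+UE) − UO)`.  (The left side is `B (α/UO − β/UE)²`, `B = UO·UE/(UO+UE)`, and
`K = AB/(A − B)` with `A = L·UE` is exactly the constant making `K p² + A q² ≥ B (p+q)²`.) -/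
theorem twoBlock_real {UO UE L : ℝ} (hUO : 0 < UO) (hUE : 0 < UE) (hL : UO < L * (UO + UE))
    (α β τ : ℝ) :
    α ^ 2 / UO + β ^ 2 / UE - (α + β) ^ 2 / (UO + UE) ≤
      L * UO * UE / (L * (UO + UE) - UO) * (τ / UE - α / UO) ^ 2 + L / UE * (β - τ) ^ 2 := by
  have hS : 0 < UO + UE := by positivity
  have hD : 0 < L * (UO + UE) - UO := sub_pos.2 hL
  have hLpos : 0 < L := by
    by_contra h
    push Not at h
    have : L * (UO + UE) ≤ 0 := mul_nonpos_of_nonpos_of_nonneg h hS.le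
    linarith
  have hUO' : UO ≠ 0 := hUO.ne'
  have hUE' : UE ≠ 0 := hUE.ne'
  have hS' : UO + UE ≠ 0 := hS.ne'
  have hD' : L * (UO + UE) - UO ≠ 0 := hD.ne'
  have hB : UO * UE / (UO + UE) * (L * UE + L * UO * UE / (L * (UO + UE) - UO)) =
      L * UE * (L * UO * UE / (L * (UO + UE) - UO)) := by
    rw [div_eq_mul_inv (L * UO * UE) (L * (UO + UE) - UO)]
    have hrel : (L * (UO + UE) - UO) * (L * (UO + UE) - UO)⁻¹ = 1 := mul_inv_cancel₀ hD'
    generalize (L * (UO + UE) - UO)⁻¹ = Dinv at hrel ⊢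
    rw [div_mul_eq_mul_div, div_eq_iff hS']
    linear_combination (-(L * UO * UE ^ 2)) * hrel
  set D0 := L * (UO + UE) - UO with hD0
  set K := L * UO * UE / D0 with hK
  set A := L * UE with hA
  set p := τ / UE - α / UO with hp
  set q := β / UE - τ / UE with hq
  have hA0 : 0 < A := by positivity
  have hK0 : 0 < K := by positivity
  have hAK : 0 < A + K := by positivity
  have lhs_eq : α ^ 2 / UO + β ^ 2 / UE - (α + β) ^ 2 / (UO + UE) =
      UO * UE / (UO + UE) * (p + q) ^ 2 := by
    rw [hp, hq]
    field_simp
    ring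
  have rhs_eq : K * (τ / UE - α / UO) ^ 2 + L / UE * (β - τ) ^ 2 = K * p ^ 2 + A * q ^ 2 := by
    rw [hp, hq, hA]
    field_simp
  rw [lhs_eq, rhs_eq]
  have h1 : (A + K) * (UO * UE / (UO + UE) * (p + q) ^ 2) ≤ (A + K) * (K * p ^ 2 + A * q ^ 2) := by
    have e : (A + K) * (UO * UE / (UO + UE) * (p + q) ^ 2) = A * K * (p + q) ^ 2 := by
      rw [← hB]; ring
    rw [e]
    nlinarith [sq_nonneg (K * p - A * q)]
  exact le_of_mul_le_mul_left h1 hAK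

/-- Complex (Hermitian) version of `twoBlock_real`: the same inequality for complex `aO, aE, t`
with `‖·‖²` (it is the sum of the real inequality for the real and for the imaginary parts). -/
theorem twoBlock_complex {UO UE L : ℝ} (hUO : 0 < UO) (hUE : 0 < UE) (hL : UO < L * (UO + UE))
    (aO aE t : ℂ) :
    ‖aO‖ ^ 2 / UO + ‖aE‖ ^ 2 / UE - ‖aO + aE‖ ^ 2 / (UO + UE) ≤
      L * UO * UE / (L * (UO + UE) - UO) * ‖t / UE - aO / UO‖ ^ 2 + L / UE * ‖aE - t‖ ^ 2 := by
  have h1 := twoBlock_real hUO hUE hL aO.re aE.re t.re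
  have h2 := twoBlock_real hUO hUE hL aO.im aE.im t.im
  have e : ∀ z : ℂ, ‖z‖ ^ 2 = z.re ^ 2 + z.im ^ 2 := fun z => by
    rw [Complex.sq_norm, Complex.normSq_apply]; ring
  simp only [e, Complex.add_re, Complex.add_im, Complex.sub_re, Complex.sub_im,
    Complex.div_ofReal_re, Complex.div_ofReal_im]
  have h := add_le_add h1 h2
  have lhs : (aO.re ^ 2 + aO.im ^ 2) / UO + (aE.re ^ 2 + aE.im ^ 2) / UE -
      ((aO.re + aE.re) ^ 2 + (aO.im + aE.im) ^ 2) / (UO + UE) =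
      (aO.re ^ 2 / UO + aE.re ^ 2 / UE - (aO.re + aE.re) ^ 2 / (UO + UE)) +
        (aO.im ^ 2 / UO + aE.im ^ 2 / UE - (aO.im + aE.im) ^ 2 / (UO + UE)) := by ring
  have rhs : L * UO * UE / (L * (UO + UE) - UO) *
        ((t.re / UE - aO.re / UO) ^ 2 + (t.im / UE - aO.im / UO) ^ 2) +
      L / UE * ((aE.re - t.re) ^ 2 + (aE.im - t.im) ^ 2) =
      (L * UO * UE / (L * (UO + UE) - UO) * (t.re / UE - aO.re / UO) ^ 2 +
          L / UE * (aE.re - t.re) ^ 2) +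
        (L * UO * UE / (L * (UO + UE) - UO) * (t.im / UE - aO.im / UO) ^ 2 +
          L / UE * (aE.im - t.im) ^ 2) := by ring
  rw [lhs, rhs]
  exact h

/-! ## Reindexing lemmas for the parity split of `[1, M]` -/

/-- The even numbers in `[1, M]` are `2·[1, ⌊M/2⌋]`. -/
theorem sum_filter_even_eq_sum_half {α : Type*} [AddCommMonoid α] (M : ℕ) (g : ℕ → α) :
    ∑ k ∈ (Icc 1 M).filter (fun k => Even k), g k = ∑ j ∈ Icc 1 (M / 2), g (2 * j) := by
  have hs : (Icc 1 M).filter (fun k => Even k) = (Icc 1 (M / 2)).image (fun j => 2 * j) := by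
    ext k
    simp only [mem_filter, mem_Icc, mem_image, Nat.even_iff]
    constructor
    · rintro ⟨⟨h1, h2⟩, h3⟩
      exact ⟨k / 2, ⟨by omega, by omega⟩, by omega⟩
    · rintro ⟨j, ⟨h1, h2⟩, rfl⟩
      exact ⟨⟨by omega, by omega⟩, by omega⟩
  rw [hs, sum_image]
  intro a _ b _ h
  simp only at h
  omega

/-- The odd numbers in `[1, M]` (`M ≥ 1`) are `1` and `2i + 1`, `1 ≤ i ≤ ⌊(M-1)/2⌋`. -/
theorem sum_filter_odd_eq_add_sum {α : Type*} [AddCommMonoid α] {M : ℕ} (hM : 1 ≤ M)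
    (g : ℕ → α) :
    ∑ r ∈ (Icc 1 M).filter (fun r => Odd r), g r =
      g 1 + ∑ i ∈ Icc 1 ((M - 1) / 2), g (2 * i + 1) := by
  have hs : (Icc 1 M).filter (fun r => Odd r) =
      insert 1 ((Icc 1 ((M - 1) / 2)).image (fun i => 2 * i + 1)) := by
    ext r
    simp only [mem_filter, mem_Icc, mem_insert, mem_image, Nat.odd_iff]
    constructor
    · rintro ⟨⟨h1, h2⟩, h3⟩
      by_cases hr : r = 1
      · exact Or.inl hr
      · exact Or.inr ⟨r / 2, ⟨by omega, by omega⟩, by omega⟩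
    · rintro (rfl | ⟨i, ⟨h1, h2⟩, rfl⟩)
      · exact ⟨⟨le_rfl, hM⟩, by omega⟩
      · exact ⟨⟨by omega, by omega⟩, by omega⟩
  rw [hs, sum_insert, sum_image]
  · intro a _ b _ h
    simp only at h
    omega
  · simp only [mem_image, mem_Icc, not_exists, not_and]
    intro i hi
    omega

/-- Dyadic decomposition of the even numbers: `{2^a m : m ≤ M odd, 1 ≤ a ≤ ⌊log₂(M/m)⌋}` is exactly
the set of even numbers in `[1, M]` (each counted once). -/
theorem sum_odd_sum_twoPow_eq_sum_even {α : Type*} [AddCommMonoid α] (M : ℕ) (g : ℕ → α) :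
    ∑ m ∈ (Icc 1 M).filter (fun m => Odd m), ∑ a ∈ Icc 1 (Nat.log 2 (M / m)), g (2 ^ a * m) =
      ∑ k ∈ (Icc 1 M).filter (fun k => Even k), g k := by
  rw [sum_sigma']
  refine sum_nbij' (fun x => 2 ^ x.2 * x.1) (fun k => ⟨ordCompl[2] k, k.factorization 2⟩)
    ?_ ?_ ?_ ?_ ?_
  · rintro ⟨m, a⟩ hx
    simp only [mem_sigma, mem_filter, mem_Icc] at hx
    obtain ⟨⟨⟨hm1, hmM⟩, hmodd⟩, ha1, haA⟩ := hx
    have hMm : M / m ≠ 0 := (Nat.div_pos hmM hm1).ne'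
    have h2a : 2 ^ a ≤ M / m :=
      (Nat.pow_le_pow_right (by norm_num) haA).trans (Nat.pow_log_le_self 2 hMm)
    simp only [mem_filter, mem_Icc]
    refine ⟨⟨Nat.mul_pos (pow_pos (by norm_num) a) hm1, (Nat.le_div_iff_mul_le hm1).1 h2a⟩, ?_⟩
    obtain ⟨b, rfl⟩ : ∃ b, a = b + 1 := ⟨a - 1, by omega⟩
    exact ⟨2 ^ b * m, by ring⟩
  · rintro k hk
    simp only [mem_filter, mem_Icc] at hk
    obtain ⟨⟨hk1, hkM⟩, hkeven⟩ := hk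
    have hk0 : k ≠ 0 := by omega
    have h2k : 2 ∣ k := even_iff_two_dvd.1 hkeven
    simp only [mem_sigma, mem_filter, mem_Icc]
    refine ⟨⟨⟨Nat.ordCompl_pos 2 hk0, (Nat.ordCompl_le k 2).trans hkM⟩, ?_⟩, ?_, ?_⟩
    · exact Nat.not_even_iff_odd.1
        (fun h => Nat.not_dvd_ordCompl Nat.prime_two hk0 (even_iff_two_dvd.1 h))
    · exact Nat.Prime.factorization_pos_of_dvd Nat.prime_two hk0 h2k
    · apply Nat.le_log_of_pow_le one_lt_two
      rw [Nat.le_div_iff_mul_le (Nat.ordCompl_pos 2 hk0), Nat.ordProj_mul_ordCompl_eq_self]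
      exact hkM
  · rintro ⟨m, a⟩ hx
    simp only [mem_sigma, mem_filter, mem_Icc] at hx
    obtain ⟨⟨⟨hm1, hmM⟩, hmodd⟩, ha1, haA⟩ := hx
    have hm0 : m ≠ 0 := by omega
    have hmf : m.factorization 2 = 0 :=
      Nat.factorization_eq_zero_of_not_dvd
        (fun h => (Nat.not_even_iff_odd.2 hmodd) (even_iff_two_dvd.2 h))
    have hf : (2 ^ a * m).factorization 2 = a := by
      rw [Nat.factorization_mul (pow_ne_zero a two_ne_zero) hm0, Finsupp.add_apply,
        Nat.Prime.factorization_pow Nat.prime_two, Finsupp.single_eq_same, hmf, add_zero]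
    simp only [Sigma.mk.injEq, heq_eq_eq]
    refine ⟨?_, hf⟩
    rw [hf]
    exact Nat.mul_div_cancel_left m (pow_pos (by norm_num) a)
  · rintro k -
    exact Nat.ordProj_mul_ordCompl_eq_self k 2
  · rintro ⟨m, a⟩ -
    rfl

/-- Geometric sum `Σ_{1 ≤ a ≤ A} 2^{-a} = 1 − 2^{-A}` (in `ℂ`). -/
theorem sum_Icc_inv_two_pow (A : ℕ) :
    ∑ a ∈ Icc 1 A, ((2 : ℂ) ^ a)⁻¹ = 1 - ((2 : ℂ) ^ A)⁻¹ := by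
  induction A with
  | zero => simp
  | succ n ih =>
    rw [Finset.sum_Icc_succ_top (by omega), ih, pow_succ, mul_inv]
    ring

/-! ## The arithmetic input of the parity step -/

/-- `log 2 · H_M > Σ_{r ≤ M odd} 1/r` for `M ≥ 6`: the odd harmonic mass is at most `1 +` the even
one, the even one is at least `1/2 + 1/4 + 1/6 = 11/12`, and `log 2 > 0.6931`. -/
theorem sum_odd_inv_lt_log_two_mul {M : ℕ} (hM : 6 ≤ M) :
    ∑ r ∈ (Icc 1 M).filter (fun r => Odd r), (1 : ℝ) / r <
      Real.log 2 * (∑ r ∈ (Icc 1 M).filter (fun r => Odd r), (1 : ℝ) / r +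
        ∑ k ∈ (Icc 1 M).filter (fun k => Even k), (1 : ℝ) / k) := by
  set PO := ∑ r ∈ (Icc 1 M).filter (fun r => Odd r), (1 : ℝ) / r with hPO
  set PE := ∑ k ∈ (Icc 1 M).filter (fun k => Even k), (1 : ℝ) / k with hPE
  have hlog : (0.6931 : ℝ) < Real.log 2 := lt_trans (by norm_num) Real.log_two_gt_d9
  -- `PE ≥ 11/12`
  have hPE1 : (11 : ℝ) / 12 ≤ PE := by
    rw [hPE, sum_filter_even_eq_sum_half]
    have hsub : Icc 1 3 ⊆ Icc 1 (M / 2) := Icc_subset_Icc le_rfl (by omega)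
    have h3 : ∑ j ∈ Icc 1 3, (1 : ℝ) / ((2 * j : ℕ) : ℝ) = 11 / 12 := by
      rw [show Icc 1 3 = {1, 2, 3} by decide]
      simp only [Finset.sum_insert (show (1 : ℕ) ∉ ({2, 3} : Finset ℕ) by decide),
        Finset.sum_insert (show (2 : ℕ) ∉ ({3} : Finset ℕ) by decide), Finset.sum_singleton]
      push_cast
      norm_num
    rw [← h3]
    exact sum_le_sum_of_subset_of_nonneg hsub fun j _ _ => by positivity
  -- `PO ≤ 1 + PE`
  have hPO1 : PO ≤ 1 + PE := by
    rw [hPO, hPE, sum_filter_odd_eq_add_sum (by omega : 1 ≤ M), sum_filter_even_eq_sum_half]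
    simp only [Nat.cast_one, div_one, add_le_add_iff_left]
    have hsub : Icc 1 ((M - 1) / 2) ⊆ Icc 1 (M / 2) := Icc_subset_Icc le_rfl (by omega)
    calc ∑ i ∈ Icc 1 ((M - 1) / 2), (1 : ℝ) / ((2 * i + 1 : ℕ) : ℝ)
        ≤ ∑ i ∈ Icc 1 ((M - 1) / 2), (1 : ℝ) / ((2 * i : ℕ) : ℝ) := by
          refine sum_le_sum fun i hi => ?_
          have hi1 : (1 : ℝ) ≤ i := by exact_mod_cast (mem_Icc.1 hi).1
          push_cast
          exact one_div_le_one_div_of_le (by positivity) (by linarith)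
      _ ≤ ∑ j ∈ Icc 1 (M / 2), (1 : ℝ) / ((2 * j : ℕ) : ℝ) :=
          sum_le_sum_of_subset_of_nonneg hsub fun j _ _ => by positivity
  have hPO0 : 0 ≤ PO := sum_nonneg fun r _ => by positivity
  nlinarith


/-- **Registered form (`stub_divisorGapTwoBlock`, uncurried) of the two-block Schur-complement inequality**
`twoBlock_complex`: the scalar core of the parity reduction of the divisor-graph Dirichlet gap. -/
theorem stub_divisorGapTwoBlock : ∀ {UO UE L : ℝ}, 0 < UO → 0 < UE → UO < L * (UO + UE) → ∀ (aO aE t : ℂ), ‖aO‖ ^ 2 / UO + ‖aE‖ ^ 2 / UE - ‖aO + aE‖ ^ 2 / (UO + UE) ≤ L * UO * UE / (L * (UO + UE) - UO) * ‖t / UE - aO / UO‖ ^ 2 + L / UE * ‖aE - t‖ ^ 2 :=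
  fun hUO hUE hL aO aE t => twoBlock_complex hUO hUE hL aO aE t

end Summit.RiemannHypothesis.RiemannHypothesis.Theorems.WeilCombBohrFejer

end
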